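import Mathlib
import Summits.Ventures.HodgeRepro2.T6Interface

/-!
# Tier7/Target — the statement (P) of README §11, typed faithfully

Sole filer: t7-lead (planner-pub-hodge-repro2-t7-lead-g0-0). Statement lane: definitions and ONE closed
`def P_T7 : Prop`; no theorem, no axiom, no `sorry`. Imports: Mathlib and the cell's own served module
`T6Interface` (the corners' complex cohomology `H1C K = H¹(∏ A_i, ℂ)` and eigenlines `eigenLine K i σ`; its
sextic `FaceSetting` is NOT used) and, through it, `Defs` (`IsWeilFace`);
the Tier-6 host-api package is NOT imported (README §11 (1)).

THE SENTENCE FORMALISED (README §11, quoted verbatim; parenthesised locators that do not resolve in this HOME are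
ignored as instructed):
«(P) for some choice of the Hecke translates, ⟨f^*Ω_s, f^*Ω_{s̄}⟩_{L²(X)} ≠ 0 — X a compact 2-ball quotient (Picard
modular surface of an anisotropic hermitian 3-space V over a Galois CM field E′ ⊇ F, [E′⁺:ℚ] ≥ 2) whose Albanese has
the four corners as isogeny factors (Liu 2021 Cor 4.20, UNCONDITIONAL at n = 3 — ROUTE.md §4 item 2 «at p = 2, n = 3,
UNCONDITIONAL — Liu Rem 4.14, DR Thm 3.2»), f the product of Hecke-translated Albanese maps, f^*Ω_s = θ(μ_0) ∧ θ(μ_1)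
and f^*Ω_{s̄} = θ(μ_2) ∧ θ(μ_3) wedges of theta lifts of U(1)-characters (BMM Cor 65 / Liu Prop 4.13, PRINTED)».

HOW THE SYMBOLS ARE TYPED (one row per symbol of the sentence).
* F = `K`: the Galois CM field of the four corners, of ANY degree (`Face K`: four CM types `T i` forming a balanced
  face, README §1 (S4) «every Galois CM field F»; NOT the cell's Tier-6 `FaceSetting`, which fixes `[F : ℚ] = 6`);
  `CMFieldOver K E'` adds that `K` is Galois CM (fields `galK`, `conjK`, `conjK_embed`).
* E′ = `E'` with `E : CMFieldOver K E'`: a number field, Galois over ℚ (`galois`), with its complex conjugation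
  `conj : E' →+* E'` (an involution inducing complex conjugation under every embedding `E' →+* ℂ`: the CM condition),
  `E′ ⊇ F` = `incl : K →+* E'`, and `[E′⁺ : ℚ] ≥ 2` = `4 ≤ finrank ℚ E'` (as `[E′ : E′⁺] = 2`).
* V = `V` with `Vh : HermitianSpace3 E V`: an `E′`-vector space of dimension 3 with a hermitian form `h`
  (linear in the first variable, `conj`-hermitian) that is anisotropic (`h v v = 0 → v = 0`).
* X = the compact Picard modular surface attached to `V` (the 2-ball quotient): typed by its COHOMOLOGICAL SHADOW
  `S : SurfaceShadow HX G` — the ℂ-algebra `HX = H^*(X_∞, ℂ)` of the tower of levels (cup product = wedge), its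
  holomorphic part `H10 = H^{1,0}`, the Hecke group `G` = the full finite-adelic group `U(V)(𝔸_{E′⁺}^∞)` acting on
  the tower by ℂ-algebra automorphisms (the Hecke translates; (H3), (H4), (H8) are printed for this group),
  complex conjugation `bar` and the integral `intX = ∫_X`; the L² pairing is the DEFINITION
  `L2 a b = ∫_X a ∧ b̄` (the Hodge inner product of holomorphic 2-forms), positive on `H10 * H10` by Hodge–Riemann.
  LEVEL: `HX` is the cohomology of the whole tower; a translated class `g • θ` lives at the level `g K g⁻¹`, the
  wedge of translated classes at the common level `X_{∩ g_i K g_i⁻¹}`, which is where `∫_X` integrates it (the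
  level of the pairing is DETERMINED by the chosen translates; there is no free existential over levels).
  The link «X is the Picard modular surface of V» is not expressible in Mathlib; the datum carries `V` and its
  shadow together, and the shadow's properties are the printed ones listed below.
* the four corners and «Albanese has the four corners as isogeny factors» = `alb : H1C K →ₗ[ℂ] HX`, the pull-back
  `f^* = (f_1^*, …, f_4^*)` on `H¹(B, ℂ) = ⊕_i H¹(A_i, ℂ)`, injective (B an isogeny factor of Alb X) and
  Hodge-type preserving.
* «the Hecke translates» = `g : Fin 4 → G`, one translate per Albanese map (`f = ∏_i (g_i ∘ f_i)`, so
  `(g_i ∘ f_i)^* e = g_i • f_i^* e`); «for some choice» = `∃ g`.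
* Ω_s = `e 0 ∧ e 1` and Ω_{s̄} = `e 2 ∧ e 3` with `e i` a non-zero vector of the eigenline of the `i`-th corner at
  `s` (i = 0, 1) resp. at `s̄` (i = 2, 3), `s ∈ T 0 ∩ T 1`, `s̄ ∈ T 2 ∩ T 3` (so all four are holomorphic); hence
  `f^*Ω_s = θ(μ_0) ∧ θ(μ_1)` and `f^*Ω_{s̄} = θ(μ_2) ∧ θ(μ_3)` are the DEFINITIONS `fOmegaS g`, `fOmegaSbar g`
  with `θ(μ_i) = f_i^* e_i = alb (e i)`, Hecke-translated.
* θ(μ_i) «theta lifts of U(1)-characters (BMM Cor 65 / Liu Prop 4.13)» = `alb (e i) ∈ omega i`, where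
  `omega i ≤ H10` is an irreducible `G`-submodule (the summand `ω(μ_i, ε_i, χ_i)` of Liu 2021 Prop 4.13).

HYPOTHESES BUILT INTO THE STATEMENT (README §11: «listing ANY hypothesis you build into the statement») — every
Prop field of the four structures below; none is a step of an argument, each is a clause of the sentence or a
printed fact about its objects:
(H1) E′ Galois CM ⊇ F, [E′⁺:ℚ] ≥ 2 (sentence); F Galois CM (README §1 (S4));
(H2) V hermitian of dimension 3, anisotropic (sentence);
(H3) the cup product of two holomorphic 1-forms is a holomorphic 2-form, and the Hecke translates act by algebra
     automorphisms preserving `H^{1,0}` (Hodge theory of the compact Kähler surface X; Hecke translates are holomorphic);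
(H4) complex conjugation is an antilinear ring involution commuting with the Hecke translates; `∫_X` is ℂ-linear,
     real, Hecke-invariant (normalised on the tower); classes of even degree commute; and `∫_X α ∧ ᾱ > 0` for
     `0 ≠ α ∈ H^{1,0} ∧ H^{1,0}` (the Hodge–Riemann bilinear relations, Voisin I Thm 6.32, on the compact Kähler surface);
(H5) the four corners form a balanced face of CM types of the Galois CM field F (README §1 (S4): `IsWeilFace`; no
     degree restriction on F);
(H6) `f^*` is injective on `H¹(B, ℂ)` and Hodge-type preserving («Albanese has the four corners as isogeny factors»,
     read as «`B = ∏ A_i` is an isogeny factor of `Alb(X)`»; Liu 2021 Cor 4.20 with Thm 4.18(1) and the pull-back (4.2));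
(H7) `s ∈ T 0 ∩ T 1`, `s̄ ∈ T 2 ∩ T 3`, `e i ≠ 0` (the sentence's `Ω_s`, `Ω_{s̄}`; the labelling of the corners);
(H8) each `θ(μ_i)` lies in a Hecke-irreducible subspace of `H^{1,0}` (Liu 2021 Prop 4.13: the summands `ω(μ, ε, χ)`
     are irreducible admissible ℂ[G(𝔸_F^∞)]-modules; BMM Cor 65);
(H9) the Hecke module of holomorphic 2-forms `H^{1,0} ∧ H^{1,0}` is semisimple — every Hecke-stable subspace is
     complemented and every non-zero one contains an irreducible (Matsushima's formula: Borel–Wallach VII Thm 3.2 +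
     3.6; adelically Liu 2021 App. D (D.1));
(H10) it is multiplicity-free (Rogawski 1990 Thm 13.3.1, Prop 14.6.2, Thms 14.6.4 / 14.6.5; Borel–Wallach VI Thm 4.11
     with Lemma 4.9 / 4.10 and BMM §6.7 for the `(2,0)`-cohomology of `U(2,1)`; through (D.1));
(H11) the centre of the Hecke group acts on each `ω(μ_i)` by a scalar (Liu 2021 App. D.1 Step 3, p. 125; Def 4.11), and THE CHOICE of
     the sentence's Albanese projections `f_i` has `χ_0 χ_1 = χ_2 χ_3` on the centre (the cell's construction,
     TIER5 (H_χ)) — `center_scalar`, `center_match`;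
(H12) THE CHOICE of the hermitian lines `W_i = (E′, disc i)` has `W_2 ⊕ W_3 ≅ W_0 ⊕ W_1` (`disc_match`; decorative
     in Lean — the tie to `omega i` is not typeable over the datum).
Every field is a printed fact about the objects (locator in its docstring; indexed by t7-lit in route/t7/LIT-INDEX.md);
NO field states the step: none asserts a non-zero wedge, a non-zero pairing, or a common constituent of the Hecke
modules generated by `θ(μ_0) ∧ θ(μ_1)` and `θ(μ_2) ∧ θ(μ_3)`.

WHAT `P_T7` IS AND IS NOT. `P_T7` quantifies over EVERY datum with the fields (H1)–(H12); the real objects of the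
sentence are one such datum, so `P_T7 → (P)`, and `P_T7` is STRICTLY STRONGER than (P): `P_T7` is not a consequence
of (H1)–(H12) — the square-zero model (`HX = ℂ ⊕ N`, `N² = 0`, `H10 = N`, `intX = 0`, `G = {1}`) satisfies every
field with zero pairing. The tier's product is therefore `p_T7` modulo a DISPLAYED residual about the real `X`:
a sorry-free `theorem p_T7_of_residual : R₁ → … → R_k → P_T7` with the `R_i` displayed hypotheses (each a
statement about the datum carrying a fact about the real `X`: NOT implied by the conclusion
`∃ g, L2 (fOmegaS g) (fOmegaSbar g) ≠ 0` over the datum, and NOT implying it by logic / linear algebra alone —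
a residual implied by the conclusion, or equivalent to it, is the target renamed; every `R_i` must FAIL in the
square-zero datum), reported verbatim on the CLOSE line; a
sorry-free `p_T7 : P_T7` closes the tier only if it consumes no hypothesis beyond the fields and does not derive
`False` from the datum.
§8(d): uses an L-value-free non-vanishing device: NO (this file states; it proves nothing).
-/

namespace Summit.Ventures.HodgeRepro2.Tier7

open Summit.Ventures.HodgeRepro2.T6

noncomputable section

/-! ## 0. Hecke-stable and Hecke-irreducible subspaces (used by the fields below) -/

section Hecke

variable {HX : Type} [Ring HX] [Algebra ℂ HX] (G : Type) [Group G] [MulAction G HX]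

/-- a subspace stable under every Hecke translate -/
def HeckeStable (U : Submodule ℂ HX) : Prop := ∀ (g : G), ∀ a ∈ U, g • a ∈ U

/-- a non-zero Hecke-stable subspace with no Hecke-stable subspace other than `⊥` and itself -/
def HeckeIrred (U : Submodule ℂ HX) : Prop :=
  U ≠ ⊥ ∧ HeckeStable G U ∧ ∀ W : Submodule ℂ HX, W ≤ U → HeckeStable G W → W = ⊥ ∨ W = U

end Hecke

/-! ## 1. The four corners: a rank-four (balanced) face of CM types of `F` — no restriction on `[F : ℚ]` -/

/-- The four corners (README §1 (S4)): four CM types `T i ⊂ Hom(F, ℂ)` forming a rank-four (balanced) face —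
`IsWeilFace K T` = each `T i` is a CM type (it contains exactly one of `φ`, `φ̄` for every `φ`) and every embedding
lies in exactly two of the `T i`. Unlike the cell's Tier-6 `FaceSetting`, no degree of `F` is imposed. -/
structure Face (K : Type) [Field K] [NumberField K] where
  /-- the four CM types (the vertices of the face) -/
  T : Fin 4 → Set (K →+* ℂ)
  /-- the face is balanced -/
  face : Summit.Ventures.HodgeRepro2.IsWeilFace K T

/-- `H^{1,0}(B) = ⊕_i ⊕_{σ ∈ T i} ℓ_{i,σ}` for `B = ∏ A_i` (the `σ`-eigenline `ℓ_{i,σ}` of `H¹(A_i, ℂ)` is of type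
`(1,0)` iff `σ ∈ T i`). -/
def Face.h10 {K : Type} [Field K] [NumberField K] (F : Face K) : Submodule ℂ (H1C K) :=
  ⨆ i : Fin 4, ⨆ σ ∈ F.T i, eigenLine K i σ

/-! ## 2. The arithmetic data: the Galois CM fields F ⊆ E′ and the anisotropic hermitian 3-space V -/

/-- The Galois CM field `E′ ⊇ F` of the sentence (`F = K`), with its complex conjugation and `[E′⁺ : ℚ] ≥ 2`. -/
structure CMFieldOver (K : Type) [Field K] [NumberField K] (E' : Type) [Field E'] [NumberField E'] where
  /-- `F` is Galois over ℚ -/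
  galK : IsGalois ℚ K
  /-- the complex conjugation of `F` -/
  conjK : K →+* K
  /-- it induces complex conjugation under every embedding `F →+* ℂ` (`F` is a CM field) -/
  conjK_embed : ∀ (σ : K →+* ℂ) (x : K), σ (conjK x) = (starRingEnd ℂ) (σ x)
  /-- `E′ ⊇ F` -/
  incl : K →+* E'
  /-- `E′` is Galois over ℚ -/
  galois : IsGalois ℚ E'
  /-- the complex conjugation `c` of `E′` -/
  conj : E' →+* E'
  /-- `c` is an involution -/
  conj_conj : ∀ x, conj (conj x) = x
  /-- `c` induces complex conjugation under every embedding `E′ →+* ℂ` (`E′` is a CM field: a totally imaginary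
  quadratic extension of the totally real fixed field `E′⁺` of `c`) -/
  conj_embed : ∀ (τ : E' →+* ℂ) (x : E'), τ (conj x) = (starRingEnd ℂ) (τ x)
  /-- `c ≠ id` (`E′` is totally imaginary, `[E′ : E′⁺] = 2`) -/
  conj_ne : ∃ x, conj x ≠ x
  /-- `c` restricts to the complex conjugation of `F` -/
  conj_incl : ∀ x, conj (incl x) = incl (conjK x)
  /-- `[E′⁺ : ℚ] ≥ 2`, i.e. `[E′ : ℚ] ≥ 4` -/
  plus_deg : 4 ≤ Module.finrank ℚ E'

/-- The anisotropic hermitian 3-space `V` over `E′`: a 3-dimensional `E′`-vector space with a hermitian form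
`h : V × V → E′` (linear in the first variable, `c`-hermitian) with `h v v = 0 → v = 0`. -/
structure HermitianSpace3 {K : Type} [Field K] [NumberField K] {E' : Type} [Field E'] [NumberField E']
    (E : CMFieldOver K E') (V : Type) [AddCommGroup V] [Module E' V] where
  /-- `dim_{E′} V = 3` -/
  dim3 : Module.finrank E' V = 3
  /-- the hermitian form -/
  h : V → V → E'
  h_add : ∀ u v w, h (u + v) w = h u w + h v w
  h_smul : ∀ (a : E') (v w : V), h (a • v) w = a * h v w
  /-- hermitian symmetry (hence `c`-semilinear in the second variable) -/
  h_herm : ∀ v w, h v w = E.conj (h w v)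
  /-- anisotropic -/
  h_aniso : ∀ v, h v v = 0 → v = 0

/-! ## 3. The cohomological shadow of the compact Picard modular surface X, with its Hecke translates and L² pairing -/

/-- What the sentence uses of `X`: the cohomology ring of the tower `H^*(X_∞, ℂ) = lim_K H^*(X_K, ℂ)`, its
holomorphic 1-forms, the Hecke translates — the full finite-adelic group `G = U(V)(𝔸_{E′⁺}^∞)` acting on the tower —
and the L² pairing. Every Prop field is a printed fact about the compact Kähler surface `X` and its Hecke translates
(header (H3), (H4), (H9), (H10)). -/
structure SurfaceShadow (HX : Type) [Ring HX] [Algebra ℂ HX] (G : Type) [Group G] [MulAction G HX] where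
  /-- `H^{1,0}(X_∞) ⊂ H^*(X_∞, ℂ)`, the holomorphic 1-forms -/
  H10 : Submodule ℂ HX
  /-- a Hecke translate acts by a ℂ-algebra automorphism of `H^*(X_∞, ℂ)` -/
  act_add : ∀ (g : G) (a b : HX), g • (a + b) = g • a + g • b
  act_mul : ∀ (g : G) (a b : HX), g • (a * b) = g • a * g • b
  act_smul : ∀ (g : G) (c : ℂ) (a : HX), g • (c • a) = c • (g • a)
  /-- Hecke translates are holomorphic: they preserve `H^{1,0}` -/
  act_H10 : ∀ (g : G), ∀ a ∈ H10, g • a ∈ H10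
  /-- complex conjugation on `H^*(X_∞, ℂ)` (the real structure `H^*(X_∞, ℝ) ⊗ ℂ`): an antilinear ring involution
  commuting with the Hecke translates -/
  bar : HX → HX
  bar_add : ∀ a b, bar (a + b) = bar a + bar b
  bar_smul : ∀ (z : ℂ) (a : HX), bar (z • a) = (starRingEnd ℂ z) • bar a
  bar_mul : ∀ a b, bar (a * b) = bar a * bar b
  bar_bar : ∀ a, bar (bar a) = a
  bar_act : ∀ (g : G) (a : HX), bar (g • a) = g • bar a
  /-- `∫_X : H^*(X_∞, ℂ) → ℂ`, integration of the top-degree component over the surface (ℂ-linear; on the tower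
  normalised by the volume of the level, so that it is Hecke-invariant) -/
  intX : HX →ₗ[ℂ] ℂ
  /-- CONVENTION (not a fact): the volume normalisation of the tower — `vol(gKg⁻¹) = vol(K)`, `G` unimodular —
  makes `∫_X` invariant under the Hecke translates -/
  intX_act : ∀ (g : G) (a : HX), intX (g • a) = intX a
  /-- the integral is real: `∫_X ᾱ = conj ∫_X α` -/
  intX_bar : ∀ a, intX (bar a) = (starRingEnd ℂ) (intX a)
  /-- classes of even degree commute: for holomorphic 2-forms `a, b`, `a ∧ b̄ = b̄ ∧ a` (graded commutativity) -/
  comm_H20 : ∀ a ∈ H10 * H10, ∀ b ∈ H10 * H10, a * bar b = bar b * a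
  /-- Hodge–Riemann for holomorphic 2-forms on the surface: `∫_X α ∧ ᾱ > 0` for `0 ≠ α ∈ H^{1,0} ∧ H^{1,0}`
  (Voisin, Hodge Theory I, Thm 6.32 with `k = 2`, `(p, q) = (2, 0)`: on a surface every `(2,0)`-class is primitive
  and `(−1)^{k(k−1)/2} i^{p−q−k} = 1`) -/
  hr_pos : ∀ a ∈ H10 * H10, a ≠ 0 → 0 < (intX (a * bar a)).re
  /-- (H9) the Hecke module of holomorphic 2-forms `H^{1,0} ∧ H^{1,0} ⊆ H^{2,0}(X_∞)` is SEMISIMPLE (Matsushima's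
  formula: Borel–Wallach Ch. VII Thm 3.2 with 3.6 (bidegrees) for a cocompact lattice; adelically Liu 2021
  Appendix D.2 (D.1): `H^i(Sh(G), ℂ) ≃ ⊕_π m_disc(π) H^i(𝔤, K_G; π_∞) ⊗ π^∞` as `G(𝔸^∞)`-modules, each `π^∞`
  irreducible admissible): every Hecke-stable subspace of it has a Hecke-stable complement in it, and every
  non-zero Hecke-stable subspace contains a Hecke-irreducible one -/
  H20_semisimple : ∀ U : Submodule ℂ HX, U ≤ H10 * H10 → HeckeStable G U →
    (∃ U' : Submodule ℂ HX, U' ≤ H10 * H10 ∧ HeckeStable G U' ∧ U ⊓ U' = ⊥ ∧ U ⊔ U' = H10 * H10) ∧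
    (U ≠ ⊥ → ∃ W : Submodule ℂ HX, W ≤ U ∧ HeckeIrred G W)
  /-- (H10) it is MULTIPLICITY-FREE: two isomorphic Hecke-irreducible subspaces of it coincide — a non-zero
  Hecke-equivariant linear map from one into another forces equality (Rogawski 1990: multiplicity one, Thm 13.3.1
  for the quasi-split group, and for the inner form `G′ = U(V)` of the compact surface Prop 14.6.2 (stable packets)
  and Thms 14.6.4 / 14.6.5 (`m(π′) ∈ {0, 1}`); through (D.1), since exactly one irreducible unitary `(𝔤, K)`-module
  of `SU(2,1)` has `H^{2,0}(𝔤, K; ·) ≠ 0`, and for it `dim H^{2,0} = 1` (Borel–Wallach 2000 Ch. VI Thm 4.11 with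
  Lemma 4.9 and 4.10; for `U(2,1)` with trivial central character BMM §6.7, the module `A(2×1, 0×1)`), a given
  `π^∞` contributes to `H^{2,0}` through at most one `π`) -/
  H20_multone : ∀ (U U' : Submodule ℂ HX), U ≤ H10 * H10 → U' ≤ H10 * H10 →
    (hU : HeckeIrred G U) → HeckeIrred G U' → ∀ φ : U →ₗ[ℂ] HX, (∀ x : U, φ x ∈ U') →
      (∀ (g : G) (x : U), φ ⟨g • (x : HX), hU.2.1 g x x.2⟩ = g • φ x) → φ ≠ 0 → U = U'

namespace SurfaceShadow

variable {HX : Type} [Ring HX] [Algebra ℂ HX] {G : Type} [Group G] [MulAction G HX] (S : SurfaceShadow HX G)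

/-- the L² pairing `⟨α, β⟩_{L²(X)} = ∫_X α ∧ β̄` (the Hodge inner product of holomorphic 2-forms) -/
def L2 (a b : HX) : ℂ := S.intX (a * S.bar b)

end SurfaceShadow

/-! ## 4. The period datum: everything the sentence (P) quantifies over -/

/-- The datum of the sentence (P): the fields `F ⊆ E′`, the space `V`, the surface shadow of `X`, the four corners
(a balanced face of CM types of `F`, `Face K`), the Hecke-translated Albanese maps `f`, the
embedding `s`, the eigenvectors `e i` defining `Ω_s = e 0 ∧ e 1` and `Ω_{s̄} = e 2 ∧ e 3`, and the theta-lift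
summands `omega i ∋ θ(μ_i)`. -/
structure PeriodDatum (K : Type) [Field K] [NumberField K] (E' : Type) [Field E'] [NumberField E']
    (V : Type) [AddCommGroup V] [Module E' V] (HX : Type) [Ring HX] [Algebra ℂ HX]
    (G : Type) [Group G] [MulAction G HX] where
  /-- `E′ ⊇ F` Galois CM, `[E′⁺ : ℚ] ≥ 2` -/
  E : CMFieldOver K E'
  /-- the anisotropic hermitian 3-space `V` over `E′` -/
  Vh : HermitianSpace3 E V
  /-- the shadow of the compact Picard modular surface `X` of `V` -/
  S : SurfaceShadow HX G
  /-- the four corners: CM types `T i` of `F` forming a balanced face (README §1 (S4); `IsWeilFace` includes the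
  CM-type condition on each `T i`) -/
  F : Face K
  /-- `f^* : H¹(B, ℂ) = ⊕_i H¹(A_i, ℂ) → H^*(X_∞, ℂ)`, the pull-back along the Albanese maps `f_i : X → A_i` -/
  alb : H1C K →ₗ[ℂ] HX
  /-- the four corners are isogeny factors of the Albanese of `X`, read as: `B = ∏ A_i` is an isogeny factor of
  `Alb(X)` (Liu 2021 Cor 4.20, the isogeny decomposition `A_K ∼ ∏ A_μ^{d(μ,K)}`, with Thm 4.18(1)
  `Ω(μ)^K ≃ Hom_E(A_K, A_μ)_ℚ` and the pull-back (4.2)): `f^*` is injective on `H¹(B, ℂ)` -/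
  alb_inj : Function.Injective alb
  /-- `f^*` preserves Hodge type: `H^{1,0}(B) → H^{1,0}(X)` -/
  alb_h10 : ∀ v ∈ F.h10, alb v ∈ S.H10
  /-- the embedding `s : F → ℂ` of the sentence -/
  s : K →+* ℂ
  /-- `s ∈ T 0 ∩ T 1` (the corners are labelled so that `Ω_s` lives on the first two) -/
  hs0 : s ∈ F.T 0
  hs1 : s ∈ F.T 1
  /-- `s̄ ∈ T 2 ∩ T 3` -/
  hs2 : (starRingEnd ℂ).comp s ∈ F.T 2
  hs3 : (starRingEnd ℂ).comp s ∈ F.T 3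
  /-- the eigenvectors: `e 0 ∈ ℓ_{0,s}`, `e 1 ∈ ℓ_{1,s}`, `e 2 ∈ ℓ_{2,s̄}`, `e 3 ∈ ℓ_{3,s̄}`, all non-zero -/
  e : Fin 4 → H1C K
  e0_mem : e 0 ∈ eigenLine K 0 s
  e1_mem : e 1 ∈ eigenLine K 1 s
  e2_mem : e 2 ∈ eigenLine K 2 ((starRingEnd ℂ).comp s)
  e3_mem : e 3 ∈ eigenLine K 3 ((starRingEnd ℂ).comp s)
  e_ne : ∀ i, e i ≠ 0
  /-- the theta-lift summands `ω(μ_i, ε_i, χ_i) ⊂ H^{1,0}(X_∞)` (Liu 2021 Prop 4.13 / BMM Cor 65) -/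
  omega : Fin 4 → Submodule ℂ HX
  omega_le : ∀ i, omega i ≤ S.H10
  /-- each is a Hecke-irreducible subspace (non-zero, Hecke-stable, no proper non-zero Hecke-stable subspace) -/
  omega_irred : ∀ i, HeckeIrred G (omega i)
  /-- `θ(μ_i) = f_i^* e_i` is a theta lift of a U(1)-character: it lies in `ω(μ_i, ε_i, χ_i)` -/
  theta_mem : ∀ i, alb (e i) ∈ omega i
  /-- (H11a) the centre `E′^1(𝔸^∞) ⊂ U(V)(𝔸^∞)` of the Hecke group acts on each summand `ω(μ_i, ε_i, χ_i)` by a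
  scalar (the central character `χ_i`: Liu 2021 App. D.1 Step 3, p. 125 ll. 24–25 «Let ω(μ, ε, χ) be the maximal
  quotient of the representation ω(ε, μ) of U(V) with central character χ», and Def 4.11, p. 46) -/
  center_scalar : ∀ i, ∀ z ∈ Subgroup.center G, ∃ c : ℂ, ∀ a ∈ omega i, z • a = c • a
  /-- (H11b) THE CHOICE OF `f`: the isogeny-factor projections `f_i : Alb(X) → A_i` of the sentence are chosen with
  `χ_0 χ_1 = χ_2 χ_3` on the centre, so the centre fixes `θ_0 θ_1 ∧ conj(θ_2 θ_3)`. A NECESSARY CONDITION of (P):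
  without it the pairing vanishes identically by `intX_act`; it excludes only data on which (P) is false. Satisfied
  by the cell's Tier-5 datum, where all `χ_i = ν̃` (TIER4 Prop. B5.3(e), B2(d); TIER5 (H_χ): «χ_aχ_b = χ_cχ_d on
  E¹(𝔸) by construction») -/
  center_match : ∀ z ∈ Subgroup.center G, ∀ a : Fin 4 → HX, (∀ i, a i ∈ omega i) →
    z • (a 0 * a 1 * S.bar (a 2 * a 3)) = a 0 * a 1 * S.bar (a 2 * a 3)
  /-- (H12) THE CHOICE OF THE HERMITIAN LINES: `ω(μ_i)` is the lift from the hermitian line `W_i = (E′, disc i)`,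
  `disc i ∈ E′⁺` non-zero; the choice of the sentence has `W_2 ⊕ W_3 ≅ W_0 ⊕ W_1`, whose DISCRIMINANT condition
  is typed: `disc 0 · disc 1` and `disc 2 · disc 3` differ by a norm (necessary — with the signatures at the real
  places, Landherr — for the isometry, which is itself necessary for a non-zero pairing: HKS conservation /
  Gong–Grenié Thm 3.10, the cell's TIER5 «W₃₄ ≅ W₁₂ is necessary»; the Tier-5 datum has equality exactly, `y = 1`).
  DECORATIVE in Lean (the tie to `omega i` is not typeable over the datum): it records the choice so that the
  lines can display it -/
  disc : Fin 4 → E'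
  disc_plus : ∀ i, E.conj (disc i) = disc i
  disc_ne : ∀ i, disc i ≠ 0
  disc_match : ∃ y : E', y ≠ 0 ∧ disc 0 * disc 1 = disc 2 * disc 3 * (y * E.conj y)

namespace PeriodDatum

variable {K : Type} [Field K] [NumberField K] {E' : Type} [Field E'] [NumberField E']
  {V : Type} [AddCommGroup V] [Module E' V] {HX : Type} [Ring HX] [Algebra ℂ HX]
  {G : Type} [Group G] [MulAction G HX] (D : PeriodDatum K E' V HX G)

/-- `θ(μ_i)` after the Hecke translate `g i`: `(g_i ∘ f_i)^* e_i = g_i • f_i^* e_i`. -/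
def theta (g : Fin 4 → G) (i : Fin 4) : HX := g i • D.alb (D.e i)

/-- `f^*Ω_s = θ(μ_0) ∧ θ(μ_1)` for the Hecke translates `g`. -/
def fOmegaS (g : Fin 4 → G) : HX := D.theta g 0 * D.theta g 1

/-- `f^*Ω_{s̄} = θ(μ_2) ∧ θ(μ_3)` for the Hecke translates `g`. -/
def fOmegaSbar (g : Fin 4 → G) : HX := D.theta g 2 * D.theta g 3

end PeriodDatum

/-! ## 5. THE TARGET -/

/-- **(P)** — README §11, verbatim: «for some choice of the Hecke translates, ⟨f^*Ω_s, f^*Ω_{s̄}⟩_{L²(X)} ≠ 0 — X a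
compact 2-ball quotient (Picard modular surface of an anisotropic hermitian 3-space V over a Galois CM field
E′ ⊇ F, [E′⁺:ℚ] ≥ 2) whose Albanese has the four corners as isogeny factors (Liu 2021 Cor 4.20, UNCONDITIONAL at
n = 3 — ROUTE.md §4 item 2 «at p = 2, n = 3, UNCONDITIONAL — Liu Rem 4.14, DR Thm 3.2»), f the product of
Hecke-translated Albanese maps, f^*Ω_s = θ(μ_0) ∧ θ(μ_1) and f^*Ω_{s̄} = θ(μ_2) ∧ θ(μ_3) wedges of theta lifts of
U(1)-characters (BMM Cor 65 / Liu Prop 4.13, PRINTED)».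

Typed: for every number field `K` (= F) and `E'` (= E′), every `E'`-vector space `V`, every ℂ-algebra `HX`
(= H^*(X_∞, ℂ)) with a group `G` (the Hecke translates) acting on it, and every period datum `D` over them (the
fields `F ⊆ E′`, the space `V`, the surface shadow of `X`, the four corners, the Albanese pull-back `f^*`, the
embedding `s`, the eigenvectors `e i`, the theta-lift summands — structure `PeriodDatum`, with the built-in
hypotheses (H1)–(H12) of the module header) there is a choice of Hecke translates `g : Fin 4 → G` with
`⟨f^*Ω_s, f^*Ω_{s̄}⟩_{L²(X)} ≠ 0`, where `f^*Ω_s = (g 0 • f_0^* e_0) ∧ (g 1 • f_1^* e_1)` and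
`f^*Ω_{s̄} = (g 2 • f_2^* e_2) ∧ (g 3 • f_3^* e_3)`. -/
def P_T7 : Prop :=
  ∀ (K : Type) [Field K] [NumberField K] (E' : Type) [Field E'] [NumberField E']
    (V : Type) [AddCommGroup V] [Module E' V] (HX : Type) [Ring HX] [Algebra ℂ HX]
    (G : Type) [Group G] [MulAction G HX] (D : PeriodDatum K E' V HX G),
    ∃ g : Fin 4 → G, D.S.L2 (D.fOmegaS g) (D.fOmegaSbar g) ≠ 0

end

end Summit.Ventures.HodgeRepro2.Tier7
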